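import Summits.ResolutionOfSingularities.ResolutionOfSingularities.Theorems.WeightedInvariantKeyRungThreeOfDropCurveSteep
import Summits.ResolutionOfSingularities.ResolutionOfSingularities.Theorems.WeightedInvariantIota3SteepLocal
import HarnessLib

/-!
# (STEEP) ⟸ (STEEP-W): at the pinned successor only the `W`-LED steep flags remain — gap list of record hD + (D-b³-point) + (STEEP-W)
# for `stub_keyRungGrHomLE_three` (door `HypersurfaceCentreConstruction`, stmt-ResolutionOfSingularities-19897)

Helper for `stub_keyRungGrHomLE_three` (def-free, `--supports 19897`).  Assembly of …KeyRungThreeOfDropCurveSteep (gap list hD + (D-b³-point) +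
(STEEP)) with the pinning theorem `Iota3.steep_pinning` (…Iota3SteepPinningW): a steep one-flag reach of the transform `g/1 = c W^ν + t⁻¹ H` along
`g₁ = α t⁻¹ + γ z + δ W` has `γ ∈ 𝔪` and `δ` a unit.

* **`Iota3.steep_of_steepW`** — (STEEP) ⟸ (STEEP-W) in hand -9's binders (the normal form `g = c W^ν + t⁻¹ H` is …TieZeroTransformShape's).
* **`keyRungGrHomLE_three_of_tieDescent_point_steepW`** (GAP LIST OF RECORD) and its (c11)-form **`keyRungGrHomLE_three_of_c11_point_steepW`** —
  `KeyRungGrHomLE 3 p ⟸` hD (resp. (c11)≤3) + (D-b³-point) [the crux] + **(STEEP-W)**: at THE pinned successor `𝔫 = (t⁻¹, z, W)` of a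
  fractional-slope curve centre tied at `λ = 0` (any presentation), for every `W`-LED parameter `g₁ = α·t⁻¹ + γ·z + δ·W` of `B_𝔫` (`δ` a unit,
  `γ ∈ 𝔪_𝔫`) and every steep weight `a/b > 1`: `g/1 ∈ ratContactFiltration g₁ a b (aν) → a·q < r·b`.  [THE residual of the curve regime: the
  push-down of the `W`-led flag `δ⁻¹g₁ = W + α′t⁻¹ + γ′z` to the pair `(y − x^b φ, x)` of `S_P` presenting the same `J₃ᵗ`, and AQS-tie-freeness
  `τ(S, f) = 0` / lex-maximality downstairs; R9 §5 `witness_lands_low`, `no_canceller` supply the arithmetic — SIGMA-ISO.md §2 (b).]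

[OURS · L1 W4.3 · audit glue; AI work, weaker than expert review; nothing here is a statement of the manuscript under review
(Hironaka 2017, [claim: Hironaka2017, status: under-review]).]

## References

* H. Hironaka, *Characteristic polyhedra of singularities*, J. Math. Kyoto Univ. 7 (1967), §3. [Hironaka1967]
* J. Włodarczyk, *Functorial resolution by torus actions*, arXiv:2203.03090, §3.3. [Wlodarczyk2022]
* hand -10, SIGMA-ISO.md (crux directory; OURS).
-/

noncomputable section

set_option linter.dupNamespace false -- mandated namespace of this single-conjunct summit

open IsLocalRing Literature.AlgebraicGeometry.Resolution
open Summit.ResolutionOfSingularities.ResolutionOfSingularities.Theorems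
open Summit.ResolutionOfSingularities.ResolutionOfSingularities.Theorems.ContactCylinder
open Summit.ResolutionOfSingularities.ResolutionOfSingularities.Cruxes.HypersurfaceCentreConstruction.LocalEngine.Iota3.RatContact

namespace Summit.ResolutionOfSingularities.ResolutionOfSingularities.Cruxes.HypersurfaceCentreConstruction.LocalEngine

namespace Iota3

/-- **(STEEP) ⟸ (STEEP-W)** in the door's binders: at the pinned successor a steep one-flag reach of the transform is `W`-led
(`Iota3.steep_pinning` applied to the normal form `g/1 = c W^ν + t⁻¹ H`), so only the `W`-led flags need the bound `a·q < r·b`.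
[OURS · L1 W4.3] [cite: Hironaka1967, §3] [cite: Wlodarczyk2022, §3.3] -/
theorem steep_of_steepW (p : ℕ)
    (hSTEEPW : ∀ (k₀ : Type) [Field k₀] [CharP k₀ p] [PerfectField k₀]
      (S : Type) [CommRing S] [Algebra k₀ S] [Algebra.EssFiniteType k₀ S] [IsRegularLocalRing S]
      (f : S), ringKrullDim S = 3 → f ≠ 0 → f ∈ (maximalIdeal S) ^ 2 →
      ∀ (P : Ideal S) [P.IsPrime], IsRegularLocalRing (S ⧸ P) → f ∈ P →
        topStratum iotaOrdEpsTau S f = {𝔮 | P ≤ 𝔮.asIdeal} → ¬ ringKrullDim (Localization.AtPrime P) ≤ 1 →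
        P ≠ maximalIdeal S →
        ∀ (x y z : S) (q r ν : ℕ) (_ : (Ideal.span ({x, y} : Set S)).IsPrime), Ideal.span {x, y, z} = maximalIdeal S →
          P = Ideal.span {x, y} → 2 ≤ q → q ≤ r → 1 ≤ ν → f ∈ maximalIdeal S ^ ν → f ∉ maximalIdeal S ^ (ν + 1) →
          IsLexMaxWeightedCentreGerm (Localization.AtPrime (Ideal.span ({x, y} : Set S)))
            (Ideal.span {algebraMap S (Localization.AtPrime (Ideal.span ({x, y} : Set S))) f})
            ![algebraMap S (Localization.AtPrime (Ideal.span ({x, y} : Set S))) y,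
              algebraMap S (Localization.AtPrime (Ideal.span ({x, y} : Set S))) x] ![r, q] (r * ν) →
          1 ≤ r / q → f ∈ weightedMonomialIdeal ![y, x] ![r / q, 1] (r / q * ν) →
          (∀ m : ℕ, jFlatT S f m = weightedMonomialIdeal ![y, x] ![r / q, 1] m) →
        ∀ (n : ℕ) (u : Fin n → S) (w : Fin n → ℕ),
          Ideal.span (Set.range u) = maximalIdeal S → (maximalIdeal S).spanFinrank = n → (∃ i, 0 < w i) →
          Ideal.span {x | ∃ i, 0 < w i ∧ x = u i} = P →
          (∀ m : ℕ, weightedMonomialIdeal u w m = jFlatT S f m) →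
          ∀ (𝔫 : Ideal (cobordantAlgebra' u w)) [𝔫.IsPrime], IsTHomogeneous u w 𝔫 → cobordantT' u w ∈ 𝔫 →
            (maximalIdeal S).map (algebraMap S (cobordantAlgebra' u w)) ≤ 𝔫 →
            ¬ extReesAlgebra.vertexIdeal (weightedMonomialIdeal u w) ≤ 𝔫 →
            ∀ (a : ℕ) (g : cobordantAlgebra' u w), algebraMap S (cobordantAlgebra' u w) f = cobordantT' u w ^ a * g →
              ¬ cobordantT' u w ∣ g →
              algebraMap (cobordantAlgebra' u w) (Localization.AtPrime 𝔫) g ∈ maximalIdeal (Localization.AtPrime 𝔫) ^ 2 →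
              f ∈ weightedMonomialIdeal ![x, y, z] ![1, r / q + 1, 1] ((r / q + 1) * ν) →
              ∀ W : cobordantAlgebra' u w, algebraMap S (cobordantAlgebra' u w) y = cobordantT' u w ^ (r / q) * W →
                𝔫 = Ideal.span {cobordantT' u w, algebraMap S (cobordantAlgebra' u w) z, W} →
                IsRegularLocalRing (Localization.AtPrime 𝔫) → ringKrullDim (Localization.AtPrime 𝔫) = (3 : ℕ) →
                Ideal.span {algebraMap _ (Localization.AtPrime 𝔫) (cobordantT' u w),
                  algebraMap _ (Localization.AtPrime 𝔫) (algebraMap S (cobordantAlgebra' u w) z),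
                  algebraMap _ (Localization.AtPrime 𝔫) W} = maximalIdeal (Localization.AtPrime 𝔫) →
              ∀ (g₁ α γ δ : Localization.AtPrime 𝔫),
                g₁ = α * algebraMap _ (Localization.AtPrime 𝔫) (cobordantT' u w) +
                  γ * algebraMap _ (Localization.AtPrime 𝔫) (algebraMap S (cobordantAlgebra' u w) z) + δ * algebraMap _ (Localization.AtPrime 𝔫) W →
                γ ∈ maximalIdeal (Localization.AtPrime 𝔫) → IsUnit δ → ∀ a b : ℕ, 0 < b → b < a →
                algebraMap (cobordantAlgebra' u w) (Localization.AtPrime 𝔫) g ∈ ratContactFiltration g₁ a b (a * ν) → a * q < r * b)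
    :
    ∀ (k₀ : Type) [Field k₀] [CharP k₀ p] [PerfectField k₀]
      (S : Type) [CommRing S] [Algebra k₀ S] [Algebra.EssFiniteType k₀ S] [IsRegularLocalRing S]
      (f : S), ringKrullDim S = 3 → f ≠ 0 → f ∈ (maximalIdeal S) ^ 2 →
      ∀ (P : Ideal S) [P.IsPrime], IsRegularLocalRing (S ⧸ P) → f ∈ P →
        topStratum iotaOrdEpsTau S f = {𝔮 | P ≤ 𝔮.asIdeal} → ¬ ringKrullDim (Localization.AtPrime P) ≤ 1 →
        P ≠ maximalIdeal S →
        ∀ (x y z : S) (q r ν : ℕ) (_ : (Ideal.span ({x, y} : Set S)).IsPrime), Ideal.span {x, y, z} = maximalIdeal S →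
          P = Ideal.span {x, y} → 2 ≤ q → q ≤ r → 1 ≤ ν → f ∈ maximalIdeal S ^ ν → f ∉ maximalIdeal S ^ (ν + 1) →
          IsLexMaxWeightedCentreGerm (Localization.AtPrime (Ideal.span ({x, y} : Set S)))
            (Ideal.span {algebraMap S (Localization.AtPrime (Ideal.span ({x, y} : Set S))) f})
            ![algebraMap S (Localization.AtPrime (Ideal.span ({x, y} : Set S))) y,
              algebraMap S (Localization.AtPrime (Ideal.span ({x, y} : Set S))) x] ![r, q] (r * ν) →
          1 ≤ r / q → f ∈ weightedMonomialIdeal ![y, x] ![r / q, 1] (r / q * ν) →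
          (∀ m : ℕ, jFlatT S f m = weightedMonomialIdeal ![y, x] ![r / q, 1] m) →
        ∀ (n : ℕ) (u : Fin n → S) (w : Fin n → ℕ),
          Ideal.span (Set.range u) = maximalIdeal S → (maximalIdeal S).spanFinrank = n → (∃ i, 0 < w i) →
          Ideal.span {x | ∃ i, 0 < w i ∧ x = u i} = P →
          (∀ m : ℕ, weightedMonomialIdeal u w m = jFlatT S f m) →
          ∀ (𝔫 : Ideal (cobordantAlgebra' u w)) [𝔫.IsPrime], IsTHomogeneous u w 𝔫 → cobordantT' u w ∈ 𝔫 →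
            (maximalIdeal S).map (algebraMap S (cobordantAlgebra' u w)) ≤ 𝔫 →
            ¬ extReesAlgebra.vertexIdeal (weightedMonomialIdeal u w) ≤ 𝔫 →
            ∀ (a : ℕ) (g : cobordantAlgebra' u w), algebraMap S (cobordantAlgebra' u w) f = cobordantT' u w ^ a * g →
              ¬ cobordantT' u w ∣ g →
              algebraMap (cobordantAlgebra' u w) (Localization.AtPrime 𝔫) g ∈ maximalIdeal (Localization.AtPrime 𝔫) ^ 2 →
              f ∈ weightedMonomialIdeal ![x, y, z] ![1, r / q + 1, 1] ((r / q + 1) * ν) →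
              ∀ W : cobordantAlgebra' u w, algebraMap S (cobordantAlgebra' u w) y = cobordantT' u w ^ (r / q) * W →
                𝔫 = Ideal.span {cobordantT' u w, algebraMap S (cobordantAlgebra' u w) z, W} →
                IsRegularLocalRing (Localization.AtPrime 𝔫) → ringKrullDim (Localization.AtPrime 𝔫) = (3 : ℕ) →
                Ideal.span {algebraMap _ (Localization.AtPrime 𝔫) (cobordantT' u w),
                  algebraMap _ (Localization.AtPrime 𝔫) (algebraMap S (cobordantAlgebra' u w) z),
                  algebraMap _ (Localization.AtPrime 𝔫) W} = maximalIdeal (Localization.AtPrime 𝔫) →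
              ∀ g₁ ∈ maximalIdeal (Localization.AtPrime 𝔫), ∀ a b : ℕ, 0 < b → b < a →
                algebraMap (cobordantAlgebra' u w) (Localization.AtPrime 𝔫) g ∈ ratContactFiltration g₁ a b (a * ν) → a * q < r * b
 := by
  intro k₀ _ _ _ S _ _ _ _ f hd hf0 hf2 P _ hreg hfP hE hP1 hPm x y z q r ν hPxy hxyz hPeq hq2 hqr hν1 hfν hfν1 hlex hb1 hadm hJ
    n u w h1 h2 h3 h4 h5 𝔫 _ hhom hT hM hV a g hfg hTg hg2 hft0 W hW h𝔫 hR1 hR2 hR3 g₁ hg₁ a' b' hb' hab' hreach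
  classical
  haveI := hR1
  have hd3 : ringKrullDim S = (3 : ℕ) := by rw [hd]; rfl
  have hrk : (maximalIdeal S).spanFinrank = 3 := by
    have h := IsRegularLocalRing.spanFinrank_maximalIdeal (R := S)
    rw [hd3] at h
    exact_mod_cast h
  have hyxz : Ideal.span (Set.range ![y, x, z]) = maximalIdeal S := by rw [range_three, Set.insert_comm]; exact hxyz
  -- the AQS-adapted normal form and the transform `g = c W^ν + t⁻¹ H`
  obtain ⟨_, hlex'⟩ := exists_isLexMax_of_eq hPeq.symm hlex
  have hcop' : Nat.Coprime r q := by simpa using hlex'.2.2.1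
  have hndvd : ¬ q ∣ r := fun hdvd => by
    have h1 : Nat.gcd r q = 1 := hcop'
    rw [Nat.gcd_eq_right hdvd] at h1
    omega
  have hsup := mem_span_pow_sup_of_curve_lexMax_frac hd P hPeq.symm hxyz hν1 hndvd hlex'
  obtain ⟨c, h, hc, hh, hf⟩ := exists_normalForm_of_mem_sup hyxz hb1 hsup hfν1
  have hpres : ∀ m : ℕ, weightedMonomialIdeal u w m = weightedMonomialIdeal ![y, x] ![r / q, 1] m := fun m => by rw [h5 m, hJ m]
  obtain ⟨H, hH⟩ := exists_transform_eq_of_normalForm hyxz hrk Nat.one_pos hb1 hfν1 hadm hh hf u w hpres W hW hfg hTg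
  have hc' : IsUnit (algebraMap (cobordantAlgebra' u w) (Localization.AtPrime 𝔫) (algebraMap S (cobordantAlgebra' u w) c)) :=
    (hc.map (algebraMap S (cobordantAlgebra' u w))).map (algebraMap (cobordantAlgebra' u w) (Localization.AtPrime 𝔫))
  have hg' : algebraMap (cobordantAlgebra' u w) (Localization.AtPrime 𝔫) g =
      algebraMap (cobordantAlgebra' u w) (Localization.AtPrime 𝔫) (algebraMap S (cobordantAlgebra' u w) c) *
        algebraMap (cobordantAlgebra' u w) (Localization.AtPrime 𝔫) W ^ ν +
      algebraMap (cobordantAlgebra' u w) (Localization.AtPrime 𝔫) (cobordantT' u w) *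
        algebraMap (cobordantAlgebra' u w) (Localization.AtPrime 𝔫) H := by
    rw [hH, map_add, map_mul, map_mul, map_pow]
  -- only `W`-led flags can be steep (`Iota3.steepBound_of_wLed`)
  rw [hg'] at hreach
  refine steepBound_of_wLed hR2 hR3 hc' hν1 (fun a₀ b₀ => a₀ * q < r * b₀) ?_ g₁ hg₁ a' b' hb' hab' hreach
  intro g₂ α γ δ hg₂ hγ hδ a₀ b₀ hb₀ hab₀ hreach₀
  rw [← hg'] at hreach₀
  exact hSTEEPW k₀ S f hd hf0 hf2 P hreg hfP hE hP1 hPm x y z q r ν hPxy hxyz hPeq hq2 hqr hν1 hfν hfν1 hlex hb1 hadm hJ n u w h1 h2 h3 h4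
    h5 𝔫 hhom hT hM hV a g hfg hTg hg2 hft0 W hW h𝔫 hR1 hR2 hR3 g₂ α γ δ hg₂ hγ hδ a₀ b₀ hb₀ hab₀ hreach₀

end Iota3

open Iota3

/-- **GAP LIST OF RECORD for `stub_keyRungGrHomLE_three` — hD + (D-b³-point) + (STEEP-W)** (module docstring): the curve regime of (D-b³)
costs exactly the bound `a·q < r·b` for the steep reaches of the transform along `W`-LED parameters of the pinned regular local threefold per
fractional tied curve centre. [OURS · L1 W4.3 · audit glue] -/
theorem keyRungGrHomLE_three_of_tieDescent_point_steepW (p : ℕ)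
    (hD : ∀ (T T' : Type) [CommRing T] [IsRegularLocalRing T] [CommRing T'] [IsRegularLocalRing T'] [Algebra T T']
      [IsLocalHom (algebraMap T T')] [Algebra.FormallySmooth T T'] [Algebra.EssFiniteType T T'] (g : T),
      ringKrullDim T' ≤ 3 → IsTiePosition T' (algebraMap T T' g) → IsTiePosition T g)
    (hPOINT : ∀ (k₀ : Type) [Field k₀] [CharP k₀ p] [PerfectField k₀]
      (S : Type) [CommRing S] [Algebra k₀ S] [Algebra.EssFiniteType k₀ S] [IsRegularLocalRing S]
      (f : S), ringKrullDim S = 3 → f ≠ 0 → f ∈ (maximalIdeal S) ^ 2 →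
      ∀ (P : Ideal S) [P.IsPrime], IsRegularLocalRing (S ⧸ P) → f ∈ P →
        topStratum iotaOrdEpsTau S f = {𝔮 | P ≤ 𝔮.asIdeal} → ¬ ringKrullDim (Localization.AtPrime P) ≤ 1 →
        P = maximalIdeal S →
        ∀ (n : ℕ) (u : Fin n → S) (w : Fin n → ℕ),
          Ideal.span (Set.range u) = maximalIdeal S → (maximalIdeal S).spanFinrank = n → (∃ i, 0 < w i) →
          Ideal.span {x | ∃ i, 0 < w i ∧ x = u i} = P →
          (∀ m : ℕ, weightedMonomialIdeal u w m = jFlatT S f m) →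
          ∀ (𝔫 : Ideal (cobordantAlgebra' u w)) [𝔫.IsPrime], IsTHomogeneous u w 𝔫 → cobordantT' u w ∈ 𝔫 →
            (maximalIdeal S).map (algebraMap S (cobordantAlgebra' u w)) ≤ 𝔫 →
            ¬ extReesAlgebra.vertexIdeal (weightedMonomialIdeal u w) ≤ 𝔫 →
            ∀ (a : ℕ) (g : cobordantAlgebra' u w), algebraMap S (cobordantAlgebra' u w) f = cobordantT' u w ^ a * g →
              ¬ cobordantT' u w ∣ g →
              algebraMap (cobordantAlgebra' u w) (Localization.AtPrime 𝔫) g ∈ maximalIdeal (Localization.AtPrime 𝔫) ^ 2 →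
              iotaFlatT (Localization.AtPrime 𝔫) (algebraMap (cobordantAlgebra' u w) (Localization.AtPrime 𝔫) g) <
                iotaFlatT S f)
    (hSTEEPW : ∀ (k₀ : Type) [Field k₀] [CharP k₀ p] [PerfectField k₀]
      (S : Type) [CommRing S] [Algebra k₀ S] [Algebra.EssFiniteType k₀ S] [IsRegularLocalRing S]
      (f : S), ringKrullDim S = 3 → f ≠ 0 → f ∈ (maximalIdeal S) ^ 2 →
      ∀ (P : Ideal S) [P.IsPrime], IsRegularLocalRing (S ⧸ P) → f ∈ P →
        topStratum iotaOrdEpsTau S f = {𝔮 | P ≤ 𝔮.asIdeal} → ¬ ringKrullDim (Localization.AtPrime P) ≤ 1 →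
        P ≠ maximalIdeal S →
        ∀ (x y z : S) (q r ν : ℕ) (_ : (Ideal.span ({x, y} : Set S)).IsPrime), Ideal.span {x, y, z} = maximalIdeal S →
          P = Ideal.span {x, y} → 2 ≤ q → q ≤ r → 1 ≤ ν → f ∈ maximalIdeal S ^ ν → f ∉ maximalIdeal S ^ (ν + 1) →
          IsLexMaxWeightedCentreGerm (Localization.AtPrime (Ideal.span ({x, y} : Set S)))
            (Ideal.span {algebraMap S (Localization.AtPrime (Ideal.span ({x, y} : Set S))) f})
            ![algebraMap S (Localization.AtPrime (Ideal.span ({x, y} : Set S))) y,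
              algebraMap S (Localization.AtPrime (Ideal.span ({x, y} : Set S))) x] ![r, q] (r * ν) →
          1 ≤ r / q → f ∈ weightedMonomialIdeal ![y, x] ![r / q, 1] (r / q * ν) →
          (∀ m : ℕ, jFlatT S f m = weightedMonomialIdeal ![y, x] ![r / q, 1] m) →
        ∀ (n : ℕ) (u : Fin n → S) (w : Fin n → ℕ),
          Ideal.span (Set.range u) = maximalIdeal S → (maximalIdeal S).spanFinrank = n → (∃ i, 0 < w i) →
          Ideal.span {x | ∃ i, 0 < w i ∧ x = u i} = P →
          (∀ m : ℕ, weightedMonomialIdeal u w m = jFlatT S f m) →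
          ∀ (𝔫 : Ideal (cobordantAlgebra' u w)) [𝔫.IsPrime], IsTHomogeneous u w 𝔫 → cobordantT' u w ∈ 𝔫 →
            (maximalIdeal S).map (algebraMap S (cobordantAlgebra' u w)) ≤ 𝔫 →
            ¬ extReesAlgebra.vertexIdeal (weightedMonomialIdeal u w) ≤ 𝔫 →
            ∀ (a : ℕ) (g : cobordantAlgebra' u w), algebraMap S (cobordantAlgebra' u w) f = cobordantT' u w ^ a * g →
              ¬ cobordantT' u w ∣ g →
              algebraMap (cobordantAlgebra' u w) (Localization.AtPrime 𝔫) g ∈ maximalIdeal (Localization.AtPrime 𝔫) ^ 2 →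
              f ∈ weightedMonomialIdeal ![x, y, z] ![1, r / q + 1, 1] ((r / q + 1) * ν) →
              ∀ W : cobordantAlgebra' u w, algebraMap S (cobordantAlgebra' u w) y = cobordantT' u w ^ (r / q) * W →
                𝔫 = Ideal.span {cobordantT' u w, algebraMap S (cobordantAlgebra' u w) z, W} →
                IsRegularLocalRing (Localization.AtPrime 𝔫) → ringKrullDim (Localization.AtPrime 𝔫) = (3 : ℕ) →
                Ideal.span {algebraMap _ (Localization.AtPrime 𝔫) (cobordantT' u w),
                  algebraMap _ (Localization.AtPrime 𝔫) (algebraMap S (cobordantAlgebra' u w) z),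
                  algebraMap _ (Localization.AtPrime 𝔫) W} = maximalIdeal (Localization.AtPrime 𝔫) →
              ∀ (g₁ α γ δ : Localization.AtPrime 𝔫),
                g₁ = α * algebraMap _ (Localization.AtPrime 𝔫) (cobordantT' u w) +
                  γ * algebraMap _ (Localization.AtPrime 𝔫) (algebraMap S (cobordantAlgebra' u w) z) + δ * algebraMap _ (Localization.AtPrime 𝔫) W →
                γ ∈ maximalIdeal (Localization.AtPrime 𝔫) → IsUnit δ → ∀ a b : ℕ, 0 < b → b < a →
                algebraMap (cobordantAlgebra' u w) (Localization.AtPrime 𝔫) g ∈ ratContactFiltration g₁ a b (a * ν) → a * q < r * b)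
    : KeyRungGrHomLE 3 p :=
  keyRungGrHomLE_three_of_tieDescent_point_steep p hD hPOINT (steep_of_steepW p hSTEEPW)

/-- **GAP LIST OF RECORD, (c11)-form — (c11)≤3 + (D-b³-point) + (STEEP-W).** [OURS · L1 W4.3 · audit glue] -/
theorem keyRungGrHomLE_three_of_c11_point_steepW (p : ℕ) (hc11 : IotaJEssSmoothCompatibleLE 3 iotaFlatT jFlatT)
    (hPOINT : ∀ (k₀ : Type) [Field k₀] [CharP k₀ p] [PerfectField k₀]
      (S : Type) [CommRing S] [Algebra k₀ S] [Algebra.EssFiniteType k₀ S] [IsRegularLocalRing S]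
      (f : S), ringKrullDim S = 3 → f ≠ 0 → f ∈ (maximalIdeal S) ^ 2 →
      ∀ (P : Ideal S) [P.IsPrime], IsRegularLocalRing (S ⧸ P) → f ∈ P →
        topStratum iotaOrdEpsTau S f = {𝔮 | P ≤ 𝔮.asIdeal} → ¬ ringKrullDim (Localization.AtPrime P) ≤ 1 →
        P = maximalIdeal S →
        ∀ (n : ℕ) (u : Fin n → S) (w : Fin n → ℕ),
          Ideal.span (Set.range u) = maximalIdeal S → (maximalIdeal S).spanFinrank = n → (∃ i, 0 < w i) →
          Ideal.span {x | ∃ i, 0 < w i ∧ x = u i} = P →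
          (∀ m : ℕ, weightedMonomialIdeal u w m = jFlatT S f m) →
          ∀ (𝔫 : Ideal (cobordantAlgebra' u w)) [𝔫.IsPrime], IsTHomogeneous u w 𝔫 → cobordantT' u w ∈ 𝔫 →
            (maximalIdeal S).map (algebraMap S (cobordantAlgebra' u w)) ≤ 𝔫 →
            ¬ extReesAlgebra.vertexIdeal (weightedMonomialIdeal u w) ≤ 𝔫 →
            ∀ (a : ℕ) (g : cobordantAlgebra' u w), algebraMap S (cobordantAlgebra' u w) f = cobordantT' u w ^ a * g →
              ¬ cobordantT' u w ∣ g →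
              algebraMap (cobordantAlgebra' u w) (Localization.AtPrime 𝔫) g ∈ maximalIdeal (Localization.AtPrime 𝔫) ^ 2 →
              iotaFlatT (Localization.AtPrime 𝔫) (algebraMap (cobordantAlgebra' u w) (Localization.AtPrime 𝔫) g) <
                iotaFlatT S f)
    (hSTEEPW : ∀ (k₀ : Type) [Field k₀] [CharP k₀ p] [PerfectField k₀]
      (S : Type) [CommRing S] [Algebra k₀ S] [Algebra.EssFiniteType k₀ S] [IsRegularLocalRing S]
      (f : S), ringKrullDim S = 3 → f ≠ 0 → f ∈ (maximalIdeal S) ^ 2 →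
      ∀ (P : Ideal S) [P.IsPrime], IsRegularLocalRing (S ⧸ P) → f ∈ P →
        topStratum iotaOrdEpsTau S f = {𝔮 | P ≤ 𝔮.asIdeal} → ¬ ringKrullDim (Localization.AtPrime P) ≤ 1 →
        P ≠ maximalIdeal S →
        ∀ (x y z : S) (q r ν : ℕ) (_ : (Ideal.span ({x, y} : Set S)).IsPrime), Ideal.span {x, y, z} = maximalIdeal S →
          P = Ideal.span {x, y} → 2 ≤ q → q ≤ r → 1 ≤ ν → f ∈ maximalIdeal S ^ ν → f ∉ maximalIdeal S ^ (ν + 1) →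
          IsLexMaxWeightedCentreGerm (Localization.AtPrime (Ideal.span ({x, y} : Set S)))
            (Ideal.span {algebraMap S (Localization.AtPrime (Ideal.span ({x, y} : Set S))) f})
            ![algebraMap S (Localization.AtPrime (Ideal.span ({x, y} : Set S))) y,
              algebraMap S (Localization.AtPrime (Ideal.span ({x, y} : Set S))) x] ![r, q] (r * ν) →
          1 ≤ r / q → f ∈ weightedMonomialIdeal ![y, x] ![r / q, 1] (r / q * ν) →
          (∀ m : ℕ, jFlatT S f m = weightedMonomialIdeal ![y, x] ![r / q, 1] m) →
        ∀ (n : ℕ) (u : Fin n → S) (w : Fin n → ℕ),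
          Ideal.span (Set.range u) = maximalIdeal S → (maximalIdeal S).spanFinrank = n → (∃ i, 0 < w i) →
          Ideal.span {x | ∃ i, 0 < w i ∧ x = u i} = P →
          (∀ m : ℕ, weightedMonomialIdeal u w m = jFlatT S f m) →
          ∀ (𝔫 : Ideal (cobordantAlgebra' u w)) [𝔫.IsPrime], IsTHomogeneous u w 𝔫 → cobordantT' u w ∈ 𝔫 →
            (maximalIdeal S).map (algebraMap S (cobordantAlgebra' u w)) ≤ 𝔫 →
            ¬ extReesAlgebra.vertexIdeal (weightedMonomialIdeal u w) ≤ 𝔫 →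
            ∀ (a : ℕ) (g : cobordantAlgebra' u w), algebraMap S (cobordantAlgebra' u w) f = cobordantT' u w ^ a * g →
              ¬ cobordantT' u w ∣ g →
              algebraMap (cobordantAlgebra' u w) (Localization.AtPrime 𝔫) g ∈ maximalIdeal (Localization.AtPrime 𝔫) ^ 2 →
              f ∈ weightedMonomialIdeal ![x, y, z] ![1, r / q + 1, 1] ((r / q + 1) * ν) →
              ∀ W : cobordantAlgebra' u w, algebraMap S (cobordantAlgebra' u w) y = cobordantT' u w ^ (r / q) * W →
                𝔫 = Ideal.span {cobordantT' u w, algebraMap S (cobordantAlgebra' u w) z, W} →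
                IsRegularLocalRing (Localization.AtPrime 𝔫) → ringKrullDim (Localization.AtPrime 𝔫) = (3 : ℕ) →
                Ideal.span {algebraMap _ (Localization.AtPrime 𝔫) (cobordantT' u w),
                  algebraMap _ (Localization.AtPrime 𝔫) (algebraMap S (cobordantAlgebra' u w) z),
                  algebraMap _ (Localization.AtPrime 𝔫) W} = maximalIdeal (Localization.AtPrime 𝔫) →
              ∀ (g₁ α γ δ : Localization.AtPrime 𝔫),
                g₁ = α * algebraMap _ (Localization.AtPrime 𝔫) (cobordantT' u w) +
                  γ * algebraMap _ (Localization.AtPrime 𝔫) (algebraMap S (cobordantAlgebra' u w) z) + δ * algebraMap _ (Localization.AtPrime 𝔫) W →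
                γ ∈ maximalIdeal (Localization.AtPrime 𝔫) → IsUnit δ → ∀ a b : ℕ, 0 < b → b < a →
                algebraMap (cobordantAlgebra' u w) (Localization.AtPrime 𝔫) g ∈ ratContactFiltration g₁ a b (a * ν) → a * q < r * b)
    : KeyRungGrHomLE 3 p :=
  keyRungGrHomLE_three_of_c11_point_steep p hc11 hPOINT (steep_of_steepW p hSTEEPW)

end Summit.ResolutionOfSingularities.ResolutionOfSingularities.Cruxes.HypersurfaceCentreConstruction.LocalEngine

end
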